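/-
Copyright (c) 2026 the pub-hodgecm-mathlib formalisation cell (harness21).  Prover seat hodgecm-mathlib-K2Liu-p02 (g7), Track B «K2-LIT» ∕ hLiu418
#184♮, #42S payer road (σ), V5-inst (f) PART 2b file 2c — the `hN` socket of `faceA4R_two_of_record` UP TO THE SPLITTING SCALAR (K2Liu-p02 (g7) bus 15:1xZ).
THEOREMS ONLY.
-/
import Summits.HodgeConjecture.HodgeConjecture.Theorems.K2LiuA7ValueUnipotentPinsN              -- ★ p860969 (`nDeltaLoc`, `tMat`, `half_deltaGram_reFrame_tensor_tMat`)
import Summits.HodgeConjecture.HodgeConjecture.Theorems.K2LiuDeltaSpTransportSiegelJunction    -- ★ A2d junction (`proj_transport_eq`, `exists_toRep_transport_eq_smul_unipotent`)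
import Summits.HodgeConjecture.HodgeConjecture.Theorems.K2LiuLocalSWTensorBigCellLetters       -- ★ `tensorEmbLoc_nElem`
import HarnessLib

/-!
# Crux `HLiu418`, (σ) V5-inst (f), file 2c: THE UNIPOTENT LAW `hN` OF THE (A4″-KR) INSTANCE, UP TO THE SPLITTING SCALAR —
# `ω^Δ(s^Δ_B (nΔ η)) Φ x = c(η) · ψ_v(η ⬝ᵥ qHerm x) · Φ x`

Cell `hodgecm-mathlib`, crux item hLiu418 = `stmt-HodgeConjecture-24832`; squad K2 ∕ K2Liu; prover K2Liu-p02 (g7).  THEOREMS ONLY (no `def`, no instance, no notation,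
no named-fact hypothesis, no `sorry`); lane `--supports stmt-HodgeConjecture-24832 --as helper`.  Binders BY VALUE exactly as ★ I-3a `K2LiuA7ValueInstanceLeviLaw`
(`Γ hΓ`: a Δ-intertwiner of the big datum; `s𝔻` + `hsproj`: a CM-model splitting of the big doubled group over `ι`; `s^Δ_B := mpTransportLoc Γ ∘ s𝔻 ∘ tensorEmbLoc`).

**`exists_toRep_nDeltaLoc_apply`**: there is `c : (Fin 4 → L⁺_v) → ℂˣ` with, for every `η`, every `Φ ∈ 𝒮(X_Δ)` and every `x ∈ X_Δ`,
`(ω^Δ(s^Δ_B (nΔ η)) Φ)(x) = c(η) · ψ_v(η ⬝ᵥ qHerm x) · Φ(x)`, `ψ_v = adeleAddCharAt (Fp L) v` — i.e. the `hN` socket of `faceA4R_two_of_record` with the pins ★ p860969 `nDeltaLoc`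
(`ι := Fin 4`) and the moment map ★ p860905 `qHerm`, modulo the scalar `c(η)` of ★ A2d `exists_toRep_transport_eq_smul_unipotent` (implementers are unique up to scalars).
CHAIN: ★ `proj_transport_eq` (`proj (s^Δ_B u) = deltaCoords ∘ ι(u) ∘ deltaCoords⁻¹`) · ★ `tensorEmbLoc_nElem` + ★ `adapt_matA_nElem` (`u = nΔ η ⊗ 1` is the adapted unipotent with block
`T_η = reindex epsV (tMat η ⊗ₖ 1)`) · ★ (U′) p860870 `exists_deltaTransport_iotaD_eq_unipotentSp_reFrame` (`= unipotentSp β b`, `b (R b′) = R (T_η b′)`) · ★ A2d (`toRep = c • t₀(b)`,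
`t₀(b) Φ x = ψ(−½β(x, b x)) Φ x`) · ★ p860969 `half_deltaGram_reFrame_tensor_tMat` (`½β(R b′, R (T_η b′)) = −η ⬝ᵥ qHerm (R b′)`).  The scalar-free `hN` (LEAD #16 «`c ≡ 1` forced»)
follows by the commutator `n(b) = [m(2), n(b∕3)]` (file 2d, (C)).
References: [Kudla1994] §3 Thm. 3.1; [Weil1964] n° 6, n° 13; [MoeglinVignerasWaldspurger1987] Chap. 2 II.1 (B), II.6; [KudlaRallis1994] §2.
HONEST LABEL.  Count-neutral helper: `HC_CM` is proved only modulo the 7 printed citations (2 remaining named inputs: hLiu418 = `stmt-HodgeConjecture-24832`,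
h413 = `stmt-HodgeConjecture-24833`) until rung 0 closes.
-/

set_option autoImplicit false
set_option linter.dupNamespace false -- the mandated namespace repeats `HodgeConjecture.HodgeConjecture`
set_option synthInstance.maxHeartbeats 200000 -- rectangular matrix products over the Π-type `L ⊗ L⁺_v` (as ★ p860598)

noncomputable section

open scoped Matrix Kronecker
open Matrix Topology
open NumberField IsDedekindDomain
open Literature.NumberTheory.Automorphic Literature.NumberTheory.Automorphic.UnitaryGroup
open Literature.NumberTheory.Automorphic.UnitaryGroup.QuadraticCoordinates
open Literature.NumberTheory.GelbartRogawski1991 Literature.NumberTheory.GelbartRogawski1991.GRConstruction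
open Literature.NumberTheory.GelbartRogawski1991.UnitaryDualPair
open Literature.NumberTheory.GelbartRogawski1991.UnitaryDualPair.LocalSplitting
open Literature.NumberTheory.GelbartRogawski1991.AdaptedBlocks
open Literature.NumberTheory.K2Lit.SiegelDoubled Literature.NumberTheory.K2Lit.LocalSiegelDoubled
open Literature.RepresentationTheory.HeisenbergGroup
open Summit.HodgeConjecture.HodgeConjecture.Cruxes.HLiu418.K2LiuLocalSWSectionDefs
open Summit.HodgeConjecture.HodgeConjecture.Cruxes.HLiu418.K2LiuLocalSWTensorAdaptedBlocks
open Summit.HodgeConjecture.HodgeConjecture.Cruxes.HLiu418.K2LiuLocalSWTensorBigCellLetters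
open Summit.HodgeConjecture.HodgeConjecture.Cruxes.HLiu418.K2LiuDoublingSchrodingerModelDefs
open Summit.HodgeConjecture.HodgeConjecture.Cruxes.HLiu418.K2LiuDoublingModelComparison
open Summit.HodgeConjecture.HodgeConjecture.Cruxes.HLiu418.K2LiuKudlaRallisMapDeltaModel
open Summit.HodgeConjecture.HodgeConjecture.Cruxes.HLiu418.K2LiuDeltaSpTransportSiegelJunction
open Summit.HodgeConjecture.HodgeConjecture.Cruxes.HLiu418.K2LiuDeltaSpTransportUnipotentExplicit
open Summit.HodgeConjecture.HodgeConjecture.Cruxes.HLiu418.K2LiuDeltaModelRealFrame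
open Summit.HodgeConjecture.HodgeConjecture.Cruxes.HLiu418.K2LiuA7ValueUnipotentPinsHerm
open Summit.HodgeConjecture.HodgeConjecture.Cruxes.HLiu418.K2LiuA7ValueUnipotentPinsN

namespace Summit.HodgeConjecture.HodgeConjecture.Cruxes.HLiu418.K2LiuA7ValueUnipotentLaw

variable (L : Type) [Field L] [NumberField L] [IsCMField L] [Algebra.IsQuadraticExtension (Fp L) L]
variable {N M : ℕ} (e : Fin N × Fin M ≃ Fin 2)
  (dV : Fin N → L) (hdV : ∀ i, IsCMField.complexConj L (dV i) = dV i) (hdV0 : ∀ i, dV i ≠ 0)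
  (dW : Fin M → L) (hdW : ∀ i, IsCMField.complexConj L (dW i) = dW i) (hdW0 : ∀ i, dW i ≠ 0)
variable {M₂ M' n' : ℕ} (eW : Fin M × Fin M₂ ≃ Fin M') (e' : Fin N × Fin M' ≃ Fin n')
  (dV' : Fin M₂ → L) (hdV' : ∀ k, IsCMField.complexConj L (dV' k) = dV' k) (hdV'0 : ∀ k, dV' k ≠ 0)
variable (v : HeightOneSpectrum (𝓞 (Fp L)))
  (Γ : SchwartzBruhat (Fin (n' + n') → v.adicCompletion (Fp L)) ≃ₗ[ℂ] SchwartzBruhat (Fin (n' + n') → v.adicCompletion (Fp L)))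
  (hΓ : IsDeltaIntertwiner L e' dV hdV (tensorFrame L dW eW dV') (tensorFrame_real L dW hdW eW dV' hdV') v Γ)
  (s𝔻 : UnitaryGroup.localPi L (IsCMField.complexConj L) (n' + n') (hermD L e' dV hdV (tensorFrame L dW eW dV') (tensorFrame_real L dW hdW eW dV' hdV')) v →*
    LocalMp (Fp L) (n' + n') (gramD L e' dV hdV (tensorFrame L dW eW dV') (tensorFrame_real L dW hdW eW dV' hdV')) v)
  (hsproj : ∀ g, MpPsi.proj _ (s𝔻 g) =
    iotaD (Fp L) L (IsCMField.complexConj L) (complexConj_imagUnit L) (imagUnit_ne_zero L) (imagUnit_mul_self L) v n'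
      (gramR_isSymm L e' dV hdV (tensorFrame L dW eW dV') (tensorFrame_real L dW hdW eW dV' hdV'))
      (hermD_eq_map_gramD L e' dV hdV (tensorFrame L dW eW dV') (tensorFrame_real L dW hdW eW dV' hdV')) g)

set_option maxHeartbeats 1600000 in -- measured: matching the (A2d)∕(β-1)∕SiegelLetters currencies of the `ℓ_Δ`-pairing and the composite splitting unfold slowly (as ★ I-3a)
include hdV0 hdW0 hdV'0 hsproj in
/-- the symplectic part of `s^Δ_B (nΔ η)` is the Siegel unipotent `unipotentSp β b` with `b (R b′) = R (T_η b′)`, `T_η = reindex epsV (tMat η ⊗ₖ 1)` (★ `proj_transport_eq` + ★ `tensorEmbLoc_nElem`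
+ ★ (U′)). [cite: Kudla1994, §3 Thm. 3.1] [cite: MoeglinVignerasWaldspurger1987, Chap. 2 II.6] -/
theorem exists_proj_transport_nDeltaLoc_eq_unipotentSp (η : Fin 4 → v.adicCompletion (Fp L)) :
    ∃ (b : (Fin (n' + n') → v.adicCompletion (Fp L)) →ₗ[v.adicCompletion (Fp L)] (Fin (n' + n') → v.adicCompletion (Fp L)))
      (hb : ∀ x x' : Fin (n' + n') → v.adicCompletion (Fp L),
        Matrix.toLinearMap₂' (v.adicCompletion (Fp L)) (deltaGramLoc L e' dV hdV (tensorFrame L dW eW dV') (tensorFrame_real L dW hdW eW dV' hdV') v) x (b x') =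
          Matrix.toLinearMap₂' (v.adicCompletion (Fp L)) (deltaGramLoc L e' dV hdV (tensorFrame L dW eW dV') (tensorFrame_real L dW hdW eW dV' hdV') v) x' (b x)),
      MpPsi.proj (localSchrodingerDelta L e' dV hdV (tensorFrame L dW eW dV') (tensorFrame_real L dW hdW eW dV' hdV') v)
          (mpTransportLoc L e' dV hdV (tensorFrame L dW eW dV') (tensorFrame_real L dW hdW eW dV' hdV') v Γ hΓ
            (s𝔻 (tensorEmbLoc L e dV hdV dW hdW eW e' dV' hdV' v (nDeltaLoc L e dV hdV dW hdW v hdV0 hdW0 η)))) = unipotentSp _ b hb ∧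
        ∀ b' : Fin n' → LocalRing L v,
          b (reFrame (Fp L) L (IsCMField.complexConj L) (complexConj_imagUnit L) (imagUnit_ne_zero L) v n' b') =
            reFrame (Fp L) L (IsCMField.complexConj L) (complexConj_imagUnit L) (imagUnit_ne_zero L) v n'
              (Matrix.reindex (epsV e eW e') (epsV e eW e') (tMat L e dV hdV dW hdW v η ⊗ₖ (1 : Matrix (Fin M₂) (Fin M₂) (LocalRing L v))) *ᵥ b') := by
  -- the adapted matrix of `u := nΔ η ⊗ 1`
  have hu : adapt (matA (Fp L) L (IsCMField.complexConj L) v n' (tensorEmbLoc L e dV hdV dW hdW eW e' dV' hdV' v (nDeltaLoc L e dV hdV dW hdW v hdV0 hdW0 η))) =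
      Matrix.fromBlocks 1 (Matrix.reindex (epsV e eW e') (epsV e eW e') (tMat L e dV hdV dW hdW v η ⊗ₖ (1 : Matrix (Fin M₂) (Fin M₂) (LocalRing L v)))) 0 1 := by
    unfold nDeltaLoc
    rw [tensorEmbLoc_nElem, adapt_matA_nElem]
  obtain ⟨b, hb, heq, hbx⟩ := exists_deltaTransport_iotaD_eq_unipotentSp_reFrame (Fp L) L (IsCMField.complexConj L) (complexConj_imagUnit L) (imagUnit_ne_zero L)
    (imagUnit_mul_self L) v n' (gramR_isSymm L e' dV hdV (tensorFrame L dW eW dV') (tensorFrame_real L dW hdW eW dV' hdV'))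
    (isUnit_det_gramR₀ L e' dV hdV hdV0 (tensorFrame L dW eW dV') (tensorFrame_real L dW hdW eW dV' hdV') (tensorFrame_ne_zero L dW eW dV' hdW0 hdV'0))
    (hermD_eq_map_gramD L e' dV hdV (tensorFrame L dW eW dV') (tensorFrame_real L dW hdW eW dV' hdV')) _ _ hu
  have key := proj_transport_eq L e' dV hdV (tensorFrame L dW eW dV') (tensorFrame_real L dW hdW eW dV' hdV') v Γ hΓ s𝔻 hsproj
    (tensorEmbLoc L e dV hdV dW hdW eW e' dV' hdV' v (nDeltaLoc L e dV hdV dW hdW v hdV0 hdW0 η))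
  exact ⟨b, hb, key.trans heq, hbx⟩

set_option maxHeartbeats 2000000 in -- measured: the composite splitting over the Mp-level terms (as ★ I-3a; term-mode `congrArg`, no `rw` on ω-terms)
include hdV0 hdW0 hdV' hdV'0 hsproj in
/-- **THE UNIPOTENT LAW AT ONE `η`, UP TO THE SPLITTING SCALAR**: `(ω^Δ(s^Δ_B (nΔ η)) Φ)(x) = c · ψ_v(η ⬝ᵥ qHerm x) · Φ(x)` for some `c ∈ ℂˣ`.
[cite: Kudla1994, §3 Thm. 3.1] [cite: Weil1964, n° 13] [cite: MoeglinVignerasWaldspurger1987, Chap. 2 II.1 (B), II.6] -/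
theorem exists_toRep_nDeltaLoc_apply_one (η : Fin 4 → v.adicCompletion (Fp L)) :
    ∃ c : ℂˣ, ∀ (Φ : SchwartzBruhat (Fin (n' + n') → v.adicCompletion (Fp L))) (x : Fin (n' + n') → v.adicCompletion (Fp L)),
        ((MpPsi.toRep (localSchrodingerDelta L e' dV hdV (tensorFrame L dW eW dV') (tensorFrame_real L dW hdW eW dV' hdV') v)
            (((mpTransportLoc L e' dV hdV (tensorFrame L dW eW dV') (tensorFrame_real L dW hdW eW dV' hdV') v Γ hΓ).toMonoidHom.comp
              (s𝔻.comp (tensorEmbLoc L e dV hdV dW hdW eW e' dV' hdV' v))) (nDeltaLoc L e dV hdV dW hdW v hdV0 hdW0 η)) Φ :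
            SchwartzBruhat (Fin (n' + n') → v.adicCompletion (Fp L))) : (Fin (n' + n') → v.adicCompletion (Fp L)) → ℂ) x =
          (c : ℂ) * (((adeleAddCharAt (Fp L) v) (η ⬝ᵥ qHerm L (complexConj_imagUnit L) (imagUnit_ne_zero L) e eW e' dV' v x) : Circle) : ℂ) *
            (Φ : (Fin (n' + n') → v.adicCompletion (Fp L)) → ℂ) x := by
  obtain ⟨b, hb, hp, hbx⟩ := exists_proj_transport_nDeltaLoc_eq_unipotentSp L e dV hdV hdV0 dW hdW hdW0 eW e' dV' hdV' hdV'0 v Γ hΓ s𝔻 hsproj η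
  -- the second-degree exponent is `−η ⬝ᵥ qHerm`
  have hq_eq : (fun x : Fin (n' + n') → v.adicCompletion (Fp L) => ⅟(2 : v.adicCompletion (Fp L)) *
      Matrix.toLinearMap₂' (v.adicCompletion (Fp L)) (deltaGramLoc L e' dV hdV (tensorFrame L dW eW dV') (tensorFrame_real L dW hdW eW dV' hdV') v) x (b x)) =
      fun x => -(η ⬝ᵥ qHerm L (complexConj_imagUnit L) (imagUnit_ne_zero L) e eW e' dV' v x) := by
    funext x
    obtain ⟨b', rfl⟩ := (reFrame (Fp L) L (IsCMField.complexConj L) (complexConj_imagUnit L) (imagUnit_ne_zero L) v n').surjective x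
    rw [hbx]
    exact half_deltaGram_reFrame_tensor_tMat L e dV hdV hdV0 dW hdW hdW0 eW e' dV' hdV' v η b'
  have hq : Continuous fun x : Fin (n' + n') → v.adicCompletion (Fp L) => ⅟(2 : v.adicCompletion (Fp L)) *
      Matrix.toLinearMap₂' (v.adicCompletion (Fp L)) (deltaGramLoc L e' dV hdV (tensorFrame L dW eW dV') (tensorFrame_real L dW hdW eW dV' hdV') v) x (b x) := by
    rw [hq_eq]
    exact (continuous_const.dotProduct (continuous_qHerm L (complexConj_imagUnit L) (imagUnit_ne_zero L) e eW e' dV' v)).neg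
  obtain ⟨c, hc⟩ := exists_toRep_transport_eq_smul_unipotent L e' dV hdV hdV0 (tensorFrame L dW eW dV') (tensorFrame_real L dW hdW eW dV' hdV')
    (tensorFrame_ne_zero L dW eW dV' hdW0 hdV'0) v _ b hb hq hp
  refine ⟨c, fun Φ x => ?_⟩
  -- evaluate A2d's operator identity at `x` (term mode: `MonoidHom.comp_apply` is `rfl`)
  have h1 := congrArg (fun F : SchwartzBruhat (Fin (n' + n') → v.adicCompletion (Fp L)) => (F : (Fin (n' + n') → v.adicCompletion (Fp L)) → ℂ) x) (hc Φ)
  have h2 : ((((c : ℂ) • unipotentEquivSB (adeleAddCharAt (Fp L) v) (isLocallyConstant_of_isContinuousNontrivial (isContinuousNontrivial_adeleAddCharAt (Fp L) v))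
        (fun x => ⅟(2 : v.adicCompletion (Fp L)) *
          Matrix.toLinearMap₂' (v.adicCompletion (Fp L)) (deltaGramLoc L e' dV hdV (tensorFrame L dW eW dV') (tensorFrame_real L dW hdW eW dV' hdV') v) x (b x)) hq Φ :
        SchwartzBruhat (Fin (n' + n') → v.adicCompletion (Fp L))) : (Fin (n' + n') → v.adicCompletion (Fp L)) → ℂ) x) =
      (c : ℂ) * (((adeleAddCharAt (Fp L) v) (η ⬝ᵥ qHerm L (complexConj_imagUnit L) (imagUnit_ne_zero L) e eW e' dV' v x) : Circle) : ℂ) *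
            (Φ : (Fin (n' + n') → v.adicCompletion (Fp L)) → ℂ) x := by
    rw [Submodule.coe_smul, Pi.smul_apply, coe_unipotentEquivSB, unipotentOp_apply, smul_eq_mul, ← mul_assoc]
    congr 2
    rw [show ⅟(2 : v.adicCompletion (Fp L)) *
        Matrix.toLinearMap₂' (v.adicCompletion (Fp L)) (deltaGramLoc L e' dV hdV (tensorFrame L dW eW dV') (tensorFrame_real L dW hdW eW dV' hdV') v) x (b x) =
        -(η ⬝ᵥ qHerm L (complexConj_imagUnit L) (imagUnit_ne_zero L) e eW e' dV' v x) from congrFun hq_eq x, neg_neg]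
  exact h1.trans h2

include hdV0 hdW0 hdV' hdV'0 hsproj in
/-- **THE UNIPOTENT LAW `hN` UP TO THE SPLITTING SCALAR**: `(ω^Δ(s^Δ_B (nΔ η)) Φ)(x) = c(η) · ψ_v(η ⬝ᵥ qHerm x) · Φ(x)` for some `c : (Fin 4 → L⁺_v) → ℂˣ` — the `hN` socket of
`faceA4R_two_of_record` (`ι := Fin 4`, `nΔ := nDeltaLoc`, `q := qHerm`, `ψ := adeleAddCharAt (Fp L) v`) modulo `c(η)`; `c ≡ 1` is file 2d (C).
[cite: Kudla1994, §3 Thm. 3.1] [cite: Weil1964, n° 13] [cite: MoeglinVignerasWaldspurger1987, Chap. 2 II.1 (B), II.6] -/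
theorem exists_toRep_nDeltaLoc_apply :
    ∃ c : (Fin 4 → v.adicCompletion (Fp L)) → ℂˣ,
      ∀ (η : Fin 4 → v.adicCompletion (Fp L)) (Φ : SchwartzBruhat (Fin (n' + n') → v.adicCompletion (Fp L))) (x : Fin (n' + n') → v.adicCompletion (Fp L)),
        ((MpPsi.toRep (localSchrodingerDelta L e' dV hdV (tensorFrame L dW eW dV') (tensorFrame_real L dW hdW eW dV' hdV') v)
            (((mpTransportLoc L e' dV hdV (tensorFrame L dW eW dV') (tensorFrame_real L dW hdW eW dV' hdV') v Γ hΓ).toMonoidHom.comp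
              (s𝔻.comp (tensorEmbLoc L e dV hdV dW hdW eW e' dV' hdV' v))) (nDeltaLoc L e dV hdV dW hdW v hdV0 hdW0 η)) Φ :
            SchwartzBruhat (Fin (n' + n') → v.adicCompletion (Fp L))) : (Fin (n' + n') → v.adicCompletion (Fp L)) → ℂ) x =
          (c η : ℂ) * (((adeleAddCharAt (Fp L) v) (η ⬝ᵥ qHerm L (complexConj_imagUnit L) (imagUnit_ne_zero L) e eW e' dV' v x) : Circle) : ℂ) *
            (Φ : (Fin (n' + n') → v.adicCompletion (Fp L)) → ℂ) x :=
  ⟨fun η => Classical.choose (exists_toRep_nDeltaLoc_apply_one L e dV hdV hdV0 dW hdW hdW0 eW e' dV' hdV' hdV'0 v Γ hΓ s𝔻 hsproj η),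
    fun η => Classical.choose_spec (exists_toRep_nDeltaLoc_apply_one L e dV hdV hdV0 dW hdW hdW0 eW e' dV' hdV' hdV'0 v Γ hΓ s𝔻 hsproj η)⟩

end Summit.HodgeConjecture.HodgeConjecture.Cruxes.HLiu418.K2LiuA7ValueUnipotentLaw

end
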